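import Summits.ResolutionOfSingularities.ResolutionOfSingularities.Theorems.FrobeniusLadderFRationalResolutionMonoidAlgebraAwayStructure
import Literature.RingTheory.RegularLocalRing.RegularRingPolynomial
import Literature.AlgebraicGeometry.Resolution.FiniteQuotientSingularityPresentation
import HarnessLib

/-!
# Crux `FrobeniusLadder.FRationalResolution` (stmt-ResolutionOfSingularities-15317), line `redirect`,
# stub `stub_diagonalizableQuotientResolution` — `κ[ℕᵃ × ℤᵇ]` IS A REGULAR RING (the target of the face-regularity slot; item (β-free)
# of MEMO-15317-leafhand2-g25 §3)

The face-regularity slot of `…MonoidAlgebraChartCertificate.chartCertificate_of_cone` (p843560) is, by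
`…MonoidAlgebraAwayStructure.isRegularRing_away_iff_of_monoid` (p843569), the regularity of the monoid algebra `κ[M]` of the face-localized
monoid, which for a regular (unimodular) face is `≃+ ℕᵃ × ℤᵇ`. Here: `κ[ℕᵃ × ℤᵇ]` is regular — it is `κ[x₁,…,x_{a+b}][1/(x_{a+1}⋯x_{a+b})]`,
by `exists_algEquiv_away` read backwards (`Q = ℕ^{a+b}`, `g = e_{a+1} + … + e_{a+b}`), and a localization of a polynomial ring over a field
is regular (`isRegularRing_mvPolynomial_iff`, `isRegularRing_localization`).

* `isRegularRing_monoidAlgebra_top` — `κ[ℕⁿ]` (as the monoid algebra of `⊤ ⊆ ℕⁿ`) is regular;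
* ★★ `isRegularRing_monoidAlgebra_free_prod_group` — `IsRegularRing (AddMonoidAlgebra κ ((Fin a →₀ ℕ) × (Fin b →₀ ℤ)))`;
* ★★ `isRegularRing_monoidAlgebra_of_addEquiv` — hence `κ[M]` is regular for any `M ≃+ (Fin a →₀ ℕ) × (Fin b →₀ ℤ)`.

Honest label: elementary toric algebra toward ONE leaf stub (no stub, crux or summit closed). No definitions, no named facts, no sorry.
[folklore; cite: CoxLittleSchenck2011, §1.1; Matsumura1987, Thm. 19.5]
-/

noncomputable section

-- single-problem summit: the doubled namespace component is forced
set_option linter.dupNamespace false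

open Literature.AlgebraicGeometry.Resolution Literature.RingTheory.RegularLocalRing

namespace Summit.ResolutionOfSingularities.ResolutionOfSingularities.Theorems.FRationalResolution.MonoidAlgebraLaurent

variable (κ : Type) [Field κ]

/-- `κ[ℕⁿ]`, presented as the monoid algebra of `⊤ ⊆ ℕⁿ`, is a regular ring (it is the polynomial ring). [cite: Matsumura1987, Thm. 19.5] -/
theorem isRegularRing_monoidAlgebra_top (n : ℕ) :
    IsRegularRing (AddMonoidAlgebra κ ↥(⊤ : AddSubmonoid (Fin n →₀ ℕ))) := by
  haveI : IsRegularRing (MvPolynomial (Fin n) κ) := (isRegularRing_mvPolynomial_iff (R := κ)).mpr inferInstance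
  exact IsRegularRing.of_ringEquiv
    (AddMonoidAlgebra.domCongr κ κ (AddSubmonoid.topEquiv : ↥(⊤ : AddSubmonoid (Fin n →₀ ℕ)) ≃+ (Fin n →₀ ℕ))).toRingEquiv.symm

/-- ★★ **`κ[ℕᵃ × ℤᵇ]` is a regular ring.** [folklore; cite: CoxLittleSchenck2011, §1.1; Matsumura1987, Thm. 19.5] -/
theorem isRegularRing_monoidAlgebra_free_prod_group (a b : ℕ) :
    IsRegularRing (AddMonoidAlgebra κ ((Fin a →₀ ℕ) × (Fin b →₀ ℤ))) := by
  classical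
  -- `Q = ℕ^{a+b}`, `g = e_{a+1} + … + e_{a+b}`
  let Q : AddSubmonoid (Fin (a + b) →₀ ℕ) := ⊤
  let gv : Fin (a + b) →₀ ℕ := Finsupp.equivFunOnFinite.symm (Fin.addCases (fun _ => 0) (fun _ => 1))
  have hgv1 : ∀ i : Fin a, gv (Fin.castAdd b i) = 0 := fun i => by
    simp [gv]
  have hgv2 : ∀ j : Fin b, gv (Fin.natAdd a j) = 1 := fun j => by
    simp [gv]
  let g : ↥Q := ⟨gv, trivial⟩
  -- `ι' (u, v) = (u, v) ∈ ℤ^{a+b}`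
  let toZa : (Fin a →₀ ℕ) →+ (Fin a →₀ ℤ) := Finsupp.mapRange.addMonoidHom (Nat.castAddMonoidHom ℤ)
  let ι' : (Fin a →₀ ℕ) × (Fin b →₀ ℤ) →+ (Fin (a + b) →₀ ℤ) :=
    AddMonoidHom.coprod ((Finsupp.mapDomain.addMonoidHom (Fin.castAdd b)).comp toZa)
      (Finsupp.mapDomain.addMonoidHom (Fin.natAdd a))
  have hnot1 : ∀ j : Fin b, Fin.natAdd a j ∉ Set.range (Fin.castAdd b : Fin a → Fin (a + b)) := by
    rintro j ⟨i, hi⟩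
    have := congrArg Fin.val hi
    simp at this
    omega
  have hnot2 : ∀ i : Fin a, Fin.castAdd b i ∉ Set.range (Fin.natAdd a : Fin b → Fin (a + b)) := by
    rintro i ⟨j, hj⟩
    have := congrArg Fin.val hj
    simp at this
    omega
  have hι'1 : ∀ (u : Fin a →₀ ℕ) (v : Fin b →₀ ℤ) (i : Fin a), ι' (u, v) (Fin.castAdd b i) = u i := by
    intro u v i
    simp only [ι', AddMonoidHom.coprod_apply, AddMonoidHom.coe_comp, Function.comp_apply, Finsupp.mapDomain.addMonoidHom_apply,
      Finsupp.coe_add, Pi.add_apply]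
    rw [Finsupp.mapDomain_apply (Fin.castAdd_injective _ _), Finsupp.mapDomain_notin_range _ _ (hnot2 i), add_zero]
    simp [toZa]
  have hι'2 : ∀ (u : Fin a →₀ ℕ) (v : Fin b →₀ ℤ) (j : Fin b), ι' (u, v) (Fin.natAdd a j) = v j := by
    intro u v j
    simp only [ι', AddMonoidHom.coprod_apply, AddMonoidHom.coe_comp, Function.comp_apply, Finsupp.mapDomain.addMonoidHom_apply,
      Finsupp.coe_add, Pi.add_apply]
    rw [Finsupp.mapDomain_notin_range _ _ (hnot1 j), Finsupp.mapDomain_apply (Fin.natAdd_injective _ _), zero_add]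
  have htoZ1 : ∀ (q : Fin (a + b) →₀ ℕ) (i : Fin (a + b)),
      (Finsupp.mapRange.addMonoidHom (Nat.castAddMonoidHom ℤ) : (Fin (a + b) →₀ ℕ) →+ (Fin (a + b) →₀ ℤ)) q i = (q i : ℤ) := by
    intro q i; simp
  have hι'inj : Function.Injective ι' := by
    rintro ⟨u, v⟩ ⟨u', v'⟩ h
    have h1 : u = u' := by
      ext i
      have := DFunLike.congr_fun h (Fin.castAdd b i)
      rw [hι'1, hι'1] at this
      exact_mod_cast this
    have h2 : v = v' := by
      ext j
      have := DFunLike.congr_fun h (Fin.natAdd a j)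
      rwa [hι'2, hι'2] at this
    rw [h1, h2]
  -- the three hypotheses of `exists_algEquiv_away`
  have hM : ∀ m : (Fin a →₀ ℕ) × (Fin b →₀ ℤ), ∃ (q : ↥Q) (k : ℕ),
      ι' m + k • (Finsupp.mapRange.addMonoidHom (Nat.castAddMonoidHom ℤ) : (Fin (a + b) →₀ ℕ) →+ (Fin (a + b) →₀ ℤ))
        (g : Fin (a + b) →₀ ℕ) =
      (Finsupp.mapRange.addMonoidHom (Nat.castAddMonoidHom ℤ) : (Fin (a + b) →₀ ℕ) →+ (Fin (a + b) →₀ ℤ)) (q : Fin (a + b) →₀ ℕ) := by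
    rintro ⟨u, v⟩
    let k : ℕ := ∑ j, (v j).natAbs
    have hk : ∀ j, 0 ≤ v j + k := by
      intro j
      have h1 : ((v j).natAbs : ℤ) ≤ k := by
        have : (v j).natAbs ≤ k := Finset.single_le_sum (f := fun j => (v j).natAbs) (fun _ _ => Nat.zero_le _) (Finset.mem_univ j)
        exact_mod_cast this
      have h2 : -v j ≤ (v j).natAbs := by
        rw [← Int.natAbs_neg]; exact Int.le_natAbs
      omega
    let w : Fin (a + b) →₀ ℤ := ι' (u, v) + k • (Finsupp.mapRange.addMonoidHom (Nat.castAddMonoidHom ℤ) :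
      (Fin (a + b) →₀ ℕ) →+ (Fin (a + b) →₀ ℤ)) gv
    have hw : ∀ i, 0 ≤ w i := by
      intro i
      refine Fin.addCases (fun i => ?_) (fun j => ?_) i
      · simp only [w, Finsupp.coe_add, Finsupp.coe_smul, Pi.add_apply, Pi.smul_apply, hι'1, htoZ1, hgv1]
        simp
      · simp only [w, Finsupp.coe_add, Finsupp.coe_smul, Pi.add_apply, Pi.smul_apply, hι'2, htoZ1, hgv2]
        simpa using hk j
    let q : Fin (a + b) →₀ ℕ := Finsupp.mapRange Int.toNat Int.toNat_zero w
    refine ⟨⟨q, trivial⟩, k, ?_⟩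
    ext i
    change w i = _
    rw [htoZ1]
    change w i = ((Finsupp.mapRange Int.toNat Int.toNat_zero w) i : ℤ)
    rw [Finsupp.mapRange_apply, Int.toNat_of_nonneg (hw i)]
  have hQM : ∀ q : ↥Q, ∃ m : (Fin a →₀ ℕ) × (Fin b →₀ ℤ),
      ι' m = (Finsupp.mapRange.addMonoidHom (Nat.castAddMonoidHom ℤ) : (Fin (a + b) →₀ ℕ) →+ (Fin (a + b) →₀ ℤ)) (q : Fin (a + b) →₀ ℕ) := by
    rintro ⟨q, -⟩
    refine ⟨(Finsupp.equivFunOnFinite.symm (fun i => q (Fin.castAdd b i)),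
      Finsupp.equivFunOnFinite.symm (fun j => (q (Fin.natAdd a j) : ℤ))), ?_⟩
    ext i
    refine Fin.addCases (fun i => ?_) (fun j => ?_) i
    · rw [hι'1, htoZ1]; simp
    · rw [hι'2, htoZ1]; simp
  have hgM : ∃ m₀ : (Fin a →₀ ℕ) × (Fin b →₀ ℤ),
      ι' m₀ + (Finsupp.mapRange.addMonoidHom (Nat.castAddMonoidHom ℤ) : (Fin (a + b) →₀ ℕ) →+ (Fin (a + b) →₀ ℤ))
        (g : Fin (a + b) →₀ ℕ) = 0 := by
    refine ⟨(0, Finsupp.equivFunOnFinite.symm (fun _ => (-1 : ℤ))), ?_⟩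
    ext i
    refine Fin.addCases (fun i => ?_) (fun j => ?_) i
    · simp only [Finsupp.coe_add, Pi.add_apply, hι'1, htoZ1, Finsupp.coe_zero, Pi.zero_apply]
      change (0 : ℤ) + ((gv (Fin.castAdd b i) : ℕ) : ℤ) = 0
      rw [hgv1]; simp
    · simp only [Finsupp.coe_add, Pi.add_apply, hι'2, htoZ1, Finsupp.coe_zero, Pi.zero_apply]
      change (Finsupp.equivFunOnFinite.symm (fun _ : Fin b => (-1 : ℤ))) j + ((gv (Fin.natAdd a j) : ℕ) : ℤ) = 0
      rw [hgv2]; simp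
  -- the localization of the (regular) polynomial ring is regular
  haveI := isRegularRing_monoidAlgebra_top κ (a + b)
  haveI : IsRegularRing (Localization.Away (AddMonoidAlgebra.single g (1 : κ) : AddMonoidAlgebra κ ↥Q)) :=
    isRegularRing_localization (Submonoid.powers _)
  exact (isRegularRing_away_iff_of_monoid κ Q g ι' hι'inj hM hQM hgM).mp inferInstance

/-- ★★ **`κ[M]` is regular for every monoid `M ≃+ ℕᵃ × ℤᵇ`** (the face-localized monoid of a unimodular face).
[folklore; cite: CoxLittleSchenck2011, §1.1] -/
theorem isRegularRing_monoidAlgebra_of_addEquiv {M : Type} [AddCommMonoid M] {a b : ℕ}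
    (e : M ≃+ (Fin a →₀ ℕ) × (Fin b →₀ ℤ)) : IsRegularRing (AddMonoidAlgebra κ M) := by
  haveI := isRegularRing_monoidAlgebra_free_prod_group κ a b
  exact IsRegularRing.of_ringEquiv (AddMonoidAlgebra.domCongr κ κ e).toRingEquiv.symm

end Summit.ResolutionOfSingularities.ResolutionOfSingularities.Theorems.FRationalResolution.MonoidAlgebraLaurent

end
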